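import Summits.AnomalousDissipation.AnomalousDissipation.Theorems.BaireTransferDenseLoudDesignerForcesStubOrbitClosure
import Summits.AnomalousDissipation.AnomalousDissipation.Theorems.MarginalStabilityChainChainRealisationStubGenericLoudPoint

/-!
# The maximal invariant core of an NS phase (line `ergodic-budget-selection-closing`,
# crux `BaireTransfer.DenseLoudDesignerForces`, stmt-AnomalousDissipation-1143) — tools stub of block N

Sorry-free topological dynamics over the landed vocabulary `…ErgodicLine.lean` (`IsNSPhase`, `IsInvariantMeasure`), the
sub-phase lemma `IsNSPhase.of_subset` of `…StubOrbitClosure.lean`, and two landed lemmas of the sibling crux file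
`…MarginalStabilityChainChainRealisationStubGenericLoudPoint.lean` (`stub_genericLoudPoint_aux_continuousOn`: `φ_t` is continuous
on `K`; `stub_genericLoudPoint_aux_ae_mem_image`: an invariant measure carried by `K` is carried by every `φ_t '' K`), reused rather
than restated.  For an NS phase `(K, φ)` — `K ⊂ H` compact, `φ_t K ⊆ K`
(`t ≥ 0`), semigroup law and joint continuity on `[0,∞) × K` — the MAXIMAL INVARIANT CORE

  `K_∞ := ⋂_{t ≥ 0} φ_t '' K`   (written `⋂ s, ⋂ (_ : 0 ≤ s), φ s '' K` throughout; no new definition is introduced)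

is a compact subset of `K` contained in every `φ_t '' K`, it is forward invariant AND `φ_t` maps it ONTO itself (`t ≥ 0`; the
classical invariance `S(t) ω(K) = ω(K)` of the `ω`-limit set of a compact forward-invariant set, Temam 1997 Ch. I Thm 1.1 — here
`ω(K) = K_∞` because the images `φ_t '' K` decrease), it is again an NS phase for the same semiflow, and every invariant
probability measure carried by `K` is carried by `K_∞` (`μ (φ_n '' K) = μ (φ_n ⁻¹' (φ_n '' K)) ≥ μ K = 1` and
`K_∞ = ⋂ₙ φ_n '' K`).  The registered tools stub `stub_invariantCoreTools` packages these seven facts.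

References: R. Temam, *Infinite-Dimensional Dynamical Systems in Mechanics and Physics* (2nd ed., Springer 1997) Ch. I §1.1;
Foias–Manley–Rosa–Temam, *Navier–Stokes Equations and Turbulence* (CUP 2001) Ch. IV §2 (invariant measures are carried by the
invariant part of a forward-invariant set).  Nothing is asserted; no definition is added.
-/

-- `Summit.<Summit>.<Problem>` is the tree's mandated summit-side namespace (CONVENTIONS §2); for this
-- single-conjunct summit the two coincide, so the duplicate is deliberate.
set_option linter.dupNamespace false

noncomputable section

open scoped BigOperators Topology ENNReal InnerProductSpace
open Filter Set Function MeasureTheory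

namespace Summit.AnomalousDissipation.AnomalousDissipation.Theorems.DenseLoudDesignerForces.Ergodic

open Literature.Analysis.FunctionSpaces Literature.Analysis.FunctionSpaces.Torus
open Literature.Analysis.FluidPDE Literature.Analysis.FluidPDE.Torus
open Summit.AnomalousDissipation.AnomalousDissipation.Theses.BaireTransfer
open Summit.AnomalousDissipation.AnomalousDissipation.Theorems.DenseLoudDesignerForces.Negative
open Summit.AnomalousDissipation.AnomalousDissipation.Theorems.ChainRealisation.SeparatrixFluxPinning
  (stub_genericLoudPoint_aux_continuousOn stub_genericLoudPoint_aux_ae_mem_image)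

section InvariantCore

variable {ν : ℝ} {F : (UnitAddTorus (Fin 3)) → (EuclideanSpace ℝ (Fin 3))} {K : Set Hsp} {φ : ℝ → Hsp → Hsp}

/-! ## §1 Images of the phase under the semiflow -/

/-- The images `φ_t '' K` (`t ≥ 0`) of an NS phase are compact (`φ_t` is continuous on the compact `K`). [folklore] -/
theorem stub_invariantCoreTools_aux_isCompact_image (hK : IsNSPhase ν F K φ) {t : ℝ} (ht : 0 ≤ t) :
    IsCompact (φ t '' K) :=
  hK.isCompact.image_of_continuousOn (stub_genericLoudPoint_aux_continuousOn hK ht)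

/-- Semigroup law on images: `φ_s '' (φ_r '' K) = φ_{s+r} '' K` for `s, r ≥ 0`. [folklore] -/
theorem stub_invariantCoreTools_aux_image_image (hK : IsNSPhase ν F K φ) {s r : ℝ} (hs : 0 ≤ s) (hr : 0 ≤ r) :
    φ s '' (φ r '' K) = φ (s + r) '' K := by
  rw [image_image]
  exact image_congr fun x hx => (hK.map_add s r hs hr x hx).symm

/-- The images decrease: `φ_t '' K ⊆ φ_s '' K` for `0 ≤ s ≤ t` (`φ_t '' K = φ_s '' (φ_{t-s} '' K)`). [folklore] -/
theorem stub_invariantCoreTools_aux_image_antitone (hK : IsNSPhase ν F K φ) {s t : ℝ} (hs : 0 ≤ s) (hst : s ≤ t) :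
    φ t '' K ⊆ φ s '' K := by
  have ht : t = s + (t - s) := by ring
  rw [ht, ← stub_invariantCoreTools_aux_image_image hK hs (sub_nonneg.2 hst)]
  exact image_mono (hK.mapsTo (t - s) (sub_nonneg.2 hst)).image_subset

/-! ## §2 The maximal invariant core `⋂_{t ≥ 0} φ_t '' K` -/

/-- The core lies in every image `φ_t '' K`, `t ≥ 0`: this is Mathlib's
`Set.biInter_subset_of_mem` (deprecated duplicate kept as an alias, dedup-02989). [folklore] -/
@[deprecated Set.biInter_subset_of_mem (since := "2026-08-17")]
alias stub_invariantCoreTools_aux_core_subset_image := Set.biInter_subset_of_mem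

/-- The core lies in `K` (it lies in `φ_0 '' K ⊆ K`). [folklore] -/
theorem stub_invariantCoreTools_aux_core_subset (hK : IsNSPhase ν F K φ) :
    (⋂ s : ℝ, ⋂ (_ : 0 ≤ s), φ s '' K) ⊆ K :=
  (iInter₂_subset (0 : ℝ) le_rfl).trans (hK.mapsTo 0 le_rfl).image_subset

/-- The core is closed (an intersection of compact, hence closed, images). [folklore] -/
theorem stub_invariantCoreTools_aux_isClosed_core (hK : IsNSPhase ν F K φ) :
    IsClosed (⋂ s : ℝ, ⋂ (_ : 0 ≤ s), φ s '' K) :=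
  isClosed_iInter fun _ => isClosed_iInter fun hs => (stub_invariantCoreTools_aux_isCompact_image hK hs).isClosed

/-- The core is compact (a closed subset of the compact `K`). [folklore] -/
theorem stub_invariantCoreTools_aux_isCompact_core (hK : IsNSPhase ν F K φ) :
    IsCompact (⋂ s : ℝ, ⋂ (_ : 0 ≤ s), φ s '' K) :=
  hK.isCompact.of_isClosed_subset (stub_invariantCoreTools_aux_isClosed_core hK)
    (stub_invariantCoreTools_aux_core_subset hK)

/-- The core is forward invariant: for `y ∈ ⋂_{s ≥ 0} φ_s '' K` and `t, s ≥ 0`,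
`φ_t y ∈ φ_t '' (φ_s '' K) = φ_{t+s} '' K ⊆ φ_s '' K`. [folklore] -/
theorem stub_invariantCoreTools_aux_mapsTo_core (hK : IsNSPhase ν F K φ) {t : ℝ} (ht : 0 ≤ t) :
    MapsTo (φ t) (⋂ s : ℝ, ⋂ (_ : 0 ≤ s), φ s '' K) (⋂ s : ℝ, ⋂ (_ : 0 ≤ s), φ s '' K) := by
  intro y hy
  rw [mem_iInter₂] at hy ⊢
  intro s hs
  have h1 : φ t y ∈ φ (t + s) '' K := by
    rw [← stub_invariantCoreTools_aux_image_image hK ht hs]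
    exact mem_image_of_mem _ (hy s hs)
  exact stub_invariantCoreTools_aux_image_antitone hK hs (le_add_of_nonneg_left ht) h1

/-- **The semiflow maps the core ONTO itself** (`S(t) ω(K) = ω(K)`, Temam 1997 Ch. I Thm 1.1, for the decreasing family
`φ_t '' K`): given `y` in the core and `t ≥ 0`, choose `x_n ∈ φ_n '' K` with `φ_t x_n = y` (`y ∈ φ_{t+n} '' K = φ_t '' (φ_n '' K)`);
a cluster point `x ∈ K` of `(x_n)` lies in every closed `φ_s '' K` (`x_n ∈ φ_n '' K ⊆ φ_s '' K` for `n ≥ s`), hence in the core, and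
`φ_t x = y` by continuity of `φ_t` on `K`. [cite: Temam1997, Ch. I §1.1, Thm. 1.1 (invariance of ω-limit sets)] -/
theorem stub_invariantCoreTools_aux_surjOn_core (hK : IsNSPhase ν F K φ) {t : ℝ} (ht : 0 ≤ t) :
    SurjOn (φ t) (⋂ s : ℝ, ⋂ (_ : 0 ≤ s), φ s '' K) (⋂ s : ℝ, ⋂ (_ : 0 ≤ s), φ s '' K) := by
  intro y hy
  rw [mem_iInter₂] at hy
  -- preimages of `y` under `φ_t` at every integer depth
  have hex : ∀ n : ℕ, ∃ x ∈ φ (n : ℝ) '' K, φ t x = y := fun n => by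
    have h1 : y ∈ φ (t + n) '' K := hy (t + n) (add_nonneg ht (Nat.cast_nonneg n))
    rw [← stub_invariantCoreTools_aux_image_image hK ht (Nat.cast_nonneg n)] at h1
    obtain ⟨x, hx, hxy⟩ := h1
    exact ⟨x, hx, hxy⟩
  choose x hxn hxy using hex
  have hxK : ∀ n, x n ∈ K := fun n => (hK.mapsTo n (Nat.cast_nonneg n)).image_subset (hxn n)
  obtain ⟨a, haK, ψ, hψ, hlim⟩ := hK.isCompact.tendsto_subseq hxK
  refine ⟨a, ?_, ?_⟩
  · -- the cluster point lies in the core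
    rw [mem_iInter₂]
    intro s hs
    refine (stub_invariantCoreTools_aux_isCompact_image hK hs).isClosed.mem_of_tendsto hlim
      (eventually_atTop.2 ⟨⌈s⌉₊, fun k hk => ?_⟩)
    have hsk : s ≤ ((ψ k : ℕ) : ℝ) :=
      (Nat.le_ceil s).trans (Nat.cast_le.2 (hk.trans hψ.le_apply))
    exact stub_invariantCoreTools_aux_image_antitone hK hs hsk (hxn (ψ k))
  · -- and is mapped to `y`
    have hcont : ContinuousWithinAt (φ t) K a := stub_genericLoudPoint_aux_continuousOn hK ht a haK
    have hlim' : Tendsto (x ∘ ψ) atTop (𝓝[K] a) :=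
      tendsto_nhdsWithin_iff.2 ⟨hlim, Eventually.of_forall fun k => hxK (ψ k)⟩
    have h3 : Tendsto (φ t ∘ (x ∘ ψ)) atTop (𝓝 (φ t a)) := hcont.tendsto.comp hlim'
    have h4 : φ t ∘ (x ∘ ψ) = fun _ => y := funext fun k => hxy (ψ k)
    rw [h4] at h3
    exact (tendsto_const_nhds_iff.1 h3).symm

/-- The core is an NS phase for the same semiflow (a closed forward-invariant subset of `K`: `IsNSPhase.of_subset`). [folklore] -/
theorem stub_invariantCoreTools_aux_isNSPhase_core (hK : IsNSPhase ν F K φ) :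
    IsNSPhase ν F (⋂ s : ℝ, ⋂ (_ : 0 ≤ s), φ s '' K) φ :=
  hK.of_subset (stub_invariantCoreTools_aux_core_subset hK) (stub_invariantCoreTools_aux_isClosed_core hK)
    fun _ ht => stub_invariantCoreTools_aux_mapsTo_core hK ht

/-! ## §3 Invariant measures are carried by the core -/

/-- **Invariant measures live on the core**: an invariant probability measure carried by `K` is carried by every
`φ_n '' K` (`stub_genericLoudPoint_aux_ae_mem_image`: `μ (φ_n '' K)ᶜ = μ (φ_n ⁻¹' (φ_n '' K)ᶜ) ≤ μ Kᶜ = 0`), hence — countably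
many null sets, and `φ_⌈s⌉ '' K ⊆ φ_s '' K` — by `⋂_{t ≥ 0} φ_t '' K`; it stays a probability measure and invariant.
[cite: FMRTTurbulence2001, Ch. IV §2 (invariant measures)] -/
theorem stub_invariantCoreTools_aux_isInvariantMeasure_core (hK : IsNSPhase ν F K φ) {μ : Measure Hsp}
    (hμ : IsInvariantMeasure K φ μ) : IsInvariantMeasure (⋂ s : ℝ, ⋂ (_ : 0 ≤ s), φ s '' K) φ μ where
  prob := hμ.prob
  map_eq := hμ.map_eq
  null_compl := by
    have hall : ∀ᵐ x ∂μ, ∀ n : ℕ, x ∈ φ (n : ℝ) '' K :=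
      ae_all_iff.2 fun n => stub_genericLoudPoint_aux_ae_mem_image hK hμ (Nat.cast_nonneg n)
    have hae : ∀ᵐ x ∂μ, x ∈ ⋂ s : ℝ, ⋂ (_ : 0 ≤ s), φ s '' K := by
      filter_upwards [hall] with x hx
      rw [mem_iInter₂]
      intro s hs
      exact stub_invariantCoreTools_aux_image_antitone hK hs (Nat.le_ceil s) (hx ⌈s⌉₊)
    exact mem_ae_iff.1 hae

/-! ## §4 The registered tools stub -/

/-- **Tools stub of block N (line `ergodic-budget-selection-closing`): the maximal invariant core of an NS phase.**
For an NS phase `(K, φ)` there is a compact `Kc ⊆ K` — namely `Kc = ⋂_{t ≥ 0} φ_t '' K` — contained in every `φ_t '' K`,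
forward invariant and mapped ONTO itself by every `φ_t` (`t ≥ 0`), which is again an NS phase for `φ`, and which carries every
invariant probability measure carried by `K`. [cite: Temam1997, Ch. I §1.1, Thm. 1.1 (invariance of ω-limit sets)] -/
theorem stub_invariantCoreTools {ν : ℝ} {F : (UnitAddTorus (Fin 3)) → (EuclideanSpace ℝ (Fin 3))} {K : Set Hsp}
    {φ : ℝ → Hsp → Hsp} (hK : IsNSPhase ν F K φ) :
    ∃ Kc : Set Hsp, Kc ⊆ K ∧ IsCompact Kc ∧ (∀ t : ℝ, 0 ≤ t → Kc ⊆ φ t '' K) ∧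
      (∀ t : ℝ, 0 ≤ t → MapsTo (φ t) Kc Kc) ∧ (∀ t : ℝ, 0 ≤ t → SurjOn (φ t) Kc Kc) ∧
      IsNSPhase ν F Kc φ ∧ ∀ μ : Measure Hsp, IsInvariantMeasure K φ μ → IsInvariantMeasure Kc φ μ :=
  ⟨⋂ s : ℝ, ⋂ (_ : 0 ≤ s), φ s '' K, stub_invariantCoreTools_aux_core_subset hK,
    stub_invariantCoreTools_aux_isCompact_core hK, fun t ht => iInter₂_subset t ht,
    fun _ ht => stub_invariantCoreTools_aux_mapsTo_core hK ht, fun _ ht => stub_invariantCoreTools_aux_surjOn_core hK ht,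
    stub_invariantCoreTools_aux_isNSPhase_core hK,
    fun _ hμ => stub_invariantCoreTools_aux_isInvariantMeasure_core hK hμ⟩

end InvariantCore

end Summit.AnomalousDissipation.AnomalousDissipation.Theorems.DenseLoudDesignerForces.Ergodic

end
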